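import Summits.QuantumFields.BalabanUV.T4Continuum.Support.NE3HodgeCoexactPoincare
import Summits.QuantumFields.BalabanUV.T4Continuum.Support.NE3BlockPoincareLandauEnd
import HarnessLib

/-!
# T⁴ programme, node NE3 — row H2, END (matrix directions): BLOCK-POINCARÉ AND S-BOUND OF THE CO-CLOSED HODGE COMPONENT
# `η = Y − dPot ζ` OF A k-FOLD FLAT TANGENT DIRECTION AGAINST `curl Y`, in the normalised Hilbert–Schmidt and operator-norm currencies:
# `Σ nhsNormSq η ≤ 9·(L^k)²·Σ nhsNormSq (curlAt 1 Y)`, `Σ nhsNormSq ((Qcoarse L)^[k] η) ≤ (L^k)^{4−d}·Σ nhsNormSq (curlAt 1 Y)` — N-FREE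

NE3 formalisation swarm `b2b-balaban-t4-ne3-formalise-*`, LEAF PROVER 03 (unit `b2b-balaban-t4-ne3-formalise-leaf-03`, gen 7; cell
`pub-balaban`), row **H2** of the owner's ruling ρ-g21-4 (journal l.16470 (W4)(i)); CLAIM journal l.16676; companion of
`NE3HodgeCoexactPoincare` (complex core + tangent glue), taken ENTRYWISE exactly as (72S) `NE3BlockPoincareLandauEnd` §2 takes (71S)
(`NE3BlockPoincareTangent.sum_entries_eq_card_mul_nhs`, `NE3TangentFlatStructure.iterate_Tcoarse_entry_eq_zero`,
`NE3BlockPoincareLandauEnd.flatDiv_entry_eq_zero` BY NAME).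

CONTENT (all [folklore]; 0 sorry; 0 `def`).  For `L, N ≥ 1`, an `(N·L^{j+1})`-periodic matrix direction `Y` with `TangentIter L j flat Y`,
ANY `(N·L^{j+1})`-periodic matrix potential `ζ` with `flatDiv (Y − dPot ζ) ≡ 0` (row H1 supplies one; here it is a binder), `η := Y − dPot ζ`,
`F = periodBox (N·L^{j+1})`, `σ = L^{j+1}`:
§1 bookkeeping: `curlAt_flatCfg_coexact` (`curlAt 1 η = curlAt 1 Y`), `iterate_Qcoarse_entry`, `sum_entries_curl_eq_card_mul_nhs`;
§2 **`sum_nhsNormSq_coexact_le_curl`**: `Σ_{x∈F} Σ_κ nhsNormSq (η x κ) ≤ 9·σ²·Σ_{x∈F} Σ_π nhsNormSq (curlAt 1 Y x π)` — NO factor `n`, NO `N`;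
   **`sum_nhsNormSq_iterate_Qcoarse_coexact_le_curl`**: `Σ_{z∈periodBox N} Σ_κ nhsNormSq ((Qcoarse L)^[j+1] η z κ) ≤ (σ^d)⁻¹·σ⁴·Σ_{x∈F} Σ_π
   nhsNormSq (curlAt 1 Y x π)` and its ψ-form **`sum_nhsNormSq_dPot_coexactPot_le_curl`** for `ψ := framePot L (j+1) η − ζ∘(σ•·)`
   (`(Qcoarse L)^[j+1] η = dPot ψ`, glue of file 1) — the `Σ|dψ|²` input of row H5's interpolant cost;
§3 operator norm (one factor `card n`): **`dirSq_coexact_le_curlSq`** `dirSq η F ≤ card n·9·σ²·curlSq 1 Y F`,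
   **`dirSq_iterate_Qcoarse_coexact_le_curlSq`** `dirSq ((Qcoarse L)^[j+1] η) (periodBox N) ≤ card n·(σ^d)⁻¹·σ⁴·curlSq 1 Y F`.
With `ζ = 0` these are (72S)'s Landau theorems with the gradient replaced by the curl.

HONEST FRAMING.  Flat finite-lattice vector calculus on OUR typed objects at ONE (flat) configuration; (P♮)-flat needs rows H1, H3, H4, H5
on top; (P♮) at `W ≠ 1`, (ML_w) curved, T-E_w and NE3 are NOT proved; nothing about Bałaban's minimisers; spine PROVED 0∕9; finite T⁴
rung (B)+1 — NOT infinite volume, NOT mass gap, NOT BetaPertH, NOT Clay.  ABSOLUTE RULE kept (nothing printed is a hypothesis; context only: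
[Balaban1985PropagatorsII] Thm 3.3 (3.46)).  PLACEMENT: `Summits/QuantumFields/BalabanUV/`; imports accepted modules only.
-/

set_option autoImplicit false

open scoped BigOperators Matrix.Norms.L2Operator
open Finset

namespace Summit.QuantumFields.BalabanUV.T4Continuum.NE3HodgeCoexactPoincareEnd

open Literature.MathematicalPhysics.QuantumFieldTheory.Balaban1983to89
open B7Prop1Explicit
open T4AveragingDeficitWall (Plane curlAt curl curlSq dirSq)
open T4AveragingDeficitWallBoundary (periodBox mem_periodBox card_periodBox)
open AveragingDeficitPeriodicCounting (IsPeriodicDir)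
open AveragingDeficitMultiLevelPrep (TangentIter)
open BlockAveragePushDirSplit (flat)
open MinimalActionWitness (flatCfg)
open SmoothRefineNeutral (Tcoarse)
open NE3TangentNoGoWords (dPot)
open NE3CoercivityScaling (flatDiv)
open NE3TangentFlatStructure (Qcoarse framePot iterate_Tcoarse_eq_zero_of_tangentIter iterate_Tcoarse_entry_eq_zero)
open NE3FramePotGauge (bmean)
open NE3BlockLineAverage (iterate_Qcoarse_apply)
open MatrixNorms (nhsNormSq nhsNormSq_nonneg card_mul_nhsNormSq opNorm_sq_le_card_mul_nhsNormSq nhsNormSq_le_opNorm_sq)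
open NE3BlockPoincareCore (sum_rotate3')
open NE3BlockPoincareTangent (sum_entries_eq_card_mul_nhs dirSq_le_card_mul_sum_nhs)
open NE3BlockPoincareLandauEnd (flatDiv_entry_eq_zero)
open NE3LatticeWeitzenbock (curlAt_flatCfg)
open NE3FlatWeightedCoercive (sum_nhsNormSq_curl_le_curlSq)
open NE3HodgeCoexactPoincare (fdCurl_sub_dPot iterate_Qcoarse_coexact_eq_dPot' sum_norm_sq_coexact_le_curl
  sum_norm_sq_iterate_Qcoarse_coexact_le_curl)

noncomputable section

variable {d : ℕ} {n : Type*} [Fintype n] [DecidableEq n] [Nonempty n]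

/-! ## §1 Bookkeeping: the flat dressed curl does not see `dPot ζ`; entries -/

omit [Nonempty n] in
/-- **`curlAt 1 (Y − dPot ζ) = curlAt 1 Y`**: at the flat configuration the dressed curl of an exact cochain vanishes. [folklore] -/
theorem curlAt_flatCfg_coexact (Y : Site d → Fin d → Matrix n n ℂ) (ζ : Site d → Matrix n n ℂ) (x : Site d) (μ ν : Fin d) :
    curlAt (flatCfg (d := d) (n := n)) (fun y κ => Y y κ - dPot ζ y κ) x μ ν = curlAt (flatCfg (d := d) (n := n)) Y x μ ν := by
  rw [curlAt_flatCfg, curlAt_flatCfg]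
  exact fdCurl_sub_dPot Y ζ x μ ν

omit [Nonempty n] in
/-- The straight k-block average commutes with taking a matrix entry (through leaf-04's tiling `iterate_Qcoarse_apply`). [folklore] -/
theorem iterate_Qcoarse_entry {L : ℕ} (hL : 1 ≤ L) (k : ℕ) (X : Site d → Fin d → Matrix n n ℂ) (z : Site d) (κ : Fin d) (p q : n) :
    (Qcoarse L)^[k] X z κ p q = (Qcoarse L)^[k] (fun y ν => X y ν p q) z κ := by
  rw [iterate_Qcoarse_apply hL k X z κ, iterate_Qcoarse_apply hL k (fun y ν => X y ν p q) z κ]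
  simp only [Matrix.smul_apply, Matrix.sum_apply]

/-- Entry sums of the flat curl are `card n ×` its normalised Hilbert–Schmidt squares:
`Σ_{pq} Σ_x Σ_π ‖(curlAt 1 Y x π)_{pq}‖² = card n·Σ_x Σ_π nhsNormSq (curlAt 1 Y x π)`. [folklore] -/
theorem sum_entries_curl_eq_card_mul_nhs (Y : Site d → Fin d → Matrix n n ℂ) (F : Finset (Site d)) :
    ∑ pq : n × n, ∑ x ∈ F, ∑ π : Plane d, ‖curlAt (flatCfg (d := d) (n := n)) Y x π.1.1 π.1.2 pq.1 pq.2‖ ^ 2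
      = Fintype.card n * ∑ x ∈ F, ∑ π : Plane d, nhsNormSq (curlAt (flatCfg (d := d) (n := n)) Y x π.1.1 π.1.2) := by
  rw [sum_rotate3' (Finset.univ : Finset (n × n)) F (Finset.univ : Finset (Plane d))
    (fun (pq : n × n) (x : Site d) (π : Plane d) => ‖curlAt (flatCfg (d := d) (n := n)) Y x π.1.1 π.1.2 pq.1 pq.2‖ ^ 2),
    Finset.mul_sum]
  refine Finset.sum_congr rfl fun x _ => ?_
  rw [Finset.mul_sum]
  refine Finset.sum_congr rfl fun π _ => ?_
  rw [card_mul_nhsNormSq, Fintype.sum_prod_type]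

/-! ## §2 The Hilbert–Schmidt ENDs (no factor `n`, no `N`) -/

/-- **N-FREE BLOCK-POINCARÉ OF THE CO-CLOSED COMPONENT AGAINST THE CURL, Hilbert–Schmidt currency**: `L, N ≥ 1`, `Y` an
`(N·L^{j+1})`-periodic matrix direction with `TangentIter L j flat Y`, `ζ` an `(N·L^{j+1})`-periodic matrix potential with
`flatDiv (Y − dPot ζ) ≡ 0`.  Then
`Σ_{x∈periodBox(N·L^{j+1})} Σ_κ nhsNormSq (Y x κ − dPot ζ x κ) ≤ 9·(L^{j+1})²·Σ_x Σ_π nhsNormSq (curlAt 1 Y x π)` — k-free, L-free, N-FREE,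
no factor `n`; `ζ` never estimated. [folklore] -/
theorem sum_nhsNormSq_coexact_le_curl {L : ℕ} (hL : 1 ≤ L) {N : ℕ} (hN : 1 ≤ N) {j : ℕ}
    {Y : Site d → Fin d → Matrix n n ℂ} (hYper : IsPeriodicDir Y ((N * L ^ (j + 1) : ℕ) : ℤ))
    (hY : TangentIter L j (flat (d := d) (n := n)) Y)
    {ζ : Site d → Matrix n n ℂ} (hζ : ∀ (x : Site d) (τ : Fin d), ζ (x + ((N * L ^ (j + 1) : ℕ) : ℤ) • e τ) = ζ x)
    (hdiv : ∀ x : Site d, flatDiv (fun y μ => Y y μ - dPot ζ y μ) x = 0) :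
    ∑ x ∈ periodBox (d := d) (N * L ^ (j + 1)), ∑ κ : Fin d, nhsNormSq (Y x κ - dPot ζ x κ)
      ≤ 9 * ((L : ℝ) ^ (j + 1)) ^ 2
          * ∑ x ∈ periodBox (d := d) (N * L ^ (j + 1)), ∑ π : Plane d,
              nhsNormSq (curlAt (flatCfg (d := d) (n := n)) Y x π.1.1 π.1.2) := by
  have hT : (Tcoarse L)^[j + 1] Y = 0 := iterate_Tcoarse_eq_zero_of_tangentIter hL j Y hY
  rw [show N * L ^ (j + 1) = L ^ (j + 1) * N from Nat.mul_comm _ _]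
  set F := periodBox (d := d) (L ^ (j + 1) * N) with hF
  have hent : ∀ pq : n × n, ∑ x ∈ F, ∑ κ : Fin d, ‖(Y x κ - dPot ζ x κ) pq.1 pq.2‖ ^ 2
      ≤ 9 * ((L : ℝ) ^ (j + 1)) ^ 2
          * ∑ x ∈ F, ∑ π : Plane d, ‖curlAt (flatCfg (d := d) (n := n)) Y x π.1.1 π.1.2 pq.1 pq.2‖ ^ 2 := by
    intro pq
    have hper : ∀ (x : Site d) (τ μ : Fin d),
        (fun y ν => Y y ν pq.1 pq.2) (x + ((L ^ (j + 1) * N : ℕ) : ℤ) • e τ) μ = (fun y ν => Y y ν pq.1 pq.2) x μ := by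
      intro x τ μ
      simp only
      rw [show (L ^ (j + 1) * N : ℕ) = N * L ^ (j + 1) from Nat.mul_comm _ _, hYper x τ μ]
    have hζper : ∀ (x : Site d) (τ : Fin d),
        (fun y => ζ y pq.1 pq.2) (x + ((L ^ (j + 1) * N : ℕ) : ℤ) • e τ) = (fun y => ζ y pq.1 pq.2) x := by
      intro x τ
      simp only
      rw [show (L ^ (j + 1) * N : ℕ) = N * L ^ (j + 1) from Nat.mul_comm _ _, hζ x τ]
    have hdivpq : ∀ x : Site d, ∑ μ : Fin d,
        (((fun y ν => Y y ν pq.1 pq.2) x μ - dPot (fun y => ζ y pq.1 pq.2) x μ)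
          - ((fun y ν => Y y ν pq.1 pq.2) (x - e μ) μ - dPot (fun y => ζ y pq.1 pq.2) (x - e μ) μ)) = 0 := by
      intro x
      simpa only [Matrix.sub_apply, dPot] using flatDiv_entry_eq_zero hdiv pq.1 pq.2 x
    have h := sum_norm_sq_coexact_le_curl hL hN (j + 1) (fun y ν => Y y ν pq.1 pq.2) (fun y => ζ y pq.1 pq.2) hper hζper
      (iterate_Tcoarse_entry_eq_zero L hT pq.1 pq.2) hdivpq
    simpa only [curlAt_flatCfg, Matrix.sub_apply, dPot] using h
  have hsum := Finset.sum_le_sum fun pq (_ : pq ∈ (Finset.univ : Finset (n × n))) => hent pq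
  have hE := sum_entries_eq_card_mul_nhs (fun y μ => Y y μ - dPot ζ y μ) F
  rw [← Finset.mul_sum, hE, sum_entries_curl_eq_card_mul_nhs] at hsum
  have hn : (0 : ℝ) < Fintype.card n := by exact_mod_cast Fintype.card_pos
  rw [mul_left_comm] at hsum
  exact le_of_mul_le_mul_left hsum hn

/-- **N-FREE S-BOUND OF THE CO-CLOSED COMPONENT AGAINST THE CURL, Hilbert–Schmidt currency**: under the same hypotheses,
`Σ_{z∈periodBox N} Σ_κ nhsNormSq ((Qcoarse L)^[j+1] (Y − dPot ζ) z κ) ≤ ((L^{j+1})^d)⁻¹·(L^{j+1})⁴·Σ_{x∈periodBox(N·L^{j+1})} Σ_π nhsNormSq (curlAt 1 Y x π)`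
(= `σ^{4−d}·curl²`, constant ONE). [folklore] -/
theorem sum_nhsNormSq_iterate_Qcoarse_coexact_le_curl {L : ℕ} (hL : 1 ≤ L) {N : ℕ} (hN : 1 ≤ N) {j : ℕ}
    {Y : Site d → Fin d → Matrix n n ℂ} (hYper : IsPeriodicDir Y ((N * L ^ (j + 1) : ℕ) : ℤ))
    (hY : TangentIter L j (flat (d := d) (n := n)) Y)
    {ζ : Site d → Matrix n n ℂ} (hζ : ∀ (x : Site d) (τ : Fin d), ζ (x + ((N * L ^ (j + 1) : ℕ) : ℤ) • e τ) = ζ x)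
    (hdiv : ∀ x : Site d, flatDiv (fun y μ => Y y μ - dPot ζ y μ) x = 0) :
    ∑ z ∈ periodBox (d := d) N, ∑ κ : Fin d, nhsNormSq ((Qcoarse L)^[j + 1] (fun y μ => Y y μ - dPot ζ y μ) z κ)
      ≤ ((((L ^ (j + 1) : ℕ) : ℝ)) ^ d)⁻¹ * (((L ^ (j + 1) : ℕ) : ℝ)) ^ 4
          * ∑ x ∈ periodBox (d := d) (N * L ^ (j + 1)), ∑ π : Plane d,
              nhsNormSq (curlAt (flatCfg (d := d) (n := n)) Y x π.1.1 π.1.2) := by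
  have hT : (Tcoarse L)^[j + 1] Y = 0 := iterate_Tcoarse_eq_zero_of_tangentIter hL j Y hY
  rw [show N * L ^ (j + 1) = L ^ (j + 1) * N from Nat.mul_comm _ _]
  set F := periodBox (d := d) (L ^ (j + 1) * N) with hF
  have hent : ∀ pq : n × n,
      ∑ z ∈ periodBox (d := d) N, ∑ κ : Fin d, ‖(Qcoarse L)^[j + 1] (fun y μ => Y y μ - dPot ζ y μ) z κ pq.1 pq.2‖ ^ 2
        ≤ ((((L ^ (j + 1) : ℕ) : ℝ)) ^ d)⁻¹ * (((L ^ (j + 1) : ℕ) : ℝ)) ^ 4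
            * ∑ x ∈ F, ∑ π : Plane d, ‖curlAt (flatCfg (d := d) (n := n)) Y x π.1.1 π.1.2 pq.1 pq.2‖ ^ 2 := by
    intro pq
    have hper : ∀ (x : Site d) (τ μ : Fin d),
        (fun y ν => Y y ν pq.1 pq.2) (x + ((L ^ (j + 1) * N : ℕ) : ℤ) • e τ) μ = (fun y ν => Y y ν pq.1 pq.2) x μ := by
      intro x τ μ
      simp only
      rw [show (L ^ (j + 1) * N : ℕ) = N * L ^ (j + 1) from Nat.mul_comm _ _, hYper x τ μ]
    have hζper : ∀ (x : Site d) (τ : Fin d),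
        (fun y => ζ y pq.1 pq.2) (x + ((L ^ (j + 1) * N : ℕ) : ℤ) • e τ) = (fun y => ζ y pq.1 pq.2) x := by
      intro x τ
      simp only
      rw [show (L ^ (j + 1) * N : ℕ) = N * L ^ (j + 1) from Nat.mul_comm _ _, hζ x τ]
    have hdivpq : ∀ x : Site d, ∑ μ : Fin d,
        (((fun y ν => Y y ν pq.1 pq.2) x μ - dPot (fun y => ζ y pq.1 pq.2) x μ)
          - ((fun y ν => Y y ν pq.1 pq.2) (x - e μ) μ - dPot (fun y => ζ y pq.1 pq.2) (x - e μ) μ)) = 0 := by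
      intro x
      simpa only [Matrix.sub_apply, dPot] using flatDiv_entry_eq_zero hdiv pq.1 pq.2 x
    have h := sum_norm_sq_iterate_Qcoarse_coexact_le_curl hL hN (j + 1) (fun y ν => Y y ν pq.1 pq.2) (fun y => ζ y pq.1 pq.2)
      hper hζper (iterate_Tcoarse_entry_eq_zero L hT pq.1 pq.2) hdivpq
    have hfun : (fun y ν => (fun y' μ' => Y y' μ' - dPot ζ y' μ') y ν pq.1 pq.2)
        = fun y ν => (fun y' ν' => Y y' ν' pq.1 pq.2) y ν - dPot (fun y' => ζ y' pq.1 pq.2) y ν := by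
      funext y ν
      simp only [Matrix.sub_apply, dPot]
    have hq : ∀ (z : Site d) (κ : Fin d), (Qcoarse L)^[j + 1] (fun y μ => Y y μ - dPot ζ y μ) z κ pq.1 pq.2
        = (Qcoarse L)^[j + 1] (fun y ν => (fun y' ν' => Y y' ν' pq.1 pq.2) y ν - dPot (fun y' => ζ y' pq.1 pq.2) y ν) z κ := by
      intro z κ
      rw [iterate_Qcoarse_entry hL, hfun]
    simpa only [hq, curlAt_flatCfg, Matrix.sub_apply] using h
  have hsum := Finset.sum_le_sum fun pq (_ : pq ∈ (Finset.univ : Finset (n × n))) => hent pq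
  rw [← Finset.mul_sum, sum_entries_eq_card_mul_nhs, sum_entries_curl_eq_card_mul_nhs] at hsum
  have hn : (0 : ℝ) < Fintype.card n := by exact_mod_cast Fintype.card_pos
  rw [mul_left_comm] at hsum
  exact le_of_mul_le_mul_left hsum hn

/-- **THE ψ-FORM OF THE S-BOUND** (the `Σ|dψ|²` input of row H5's interpolant cost): with
`ψ := framePot L (j+1) (Y − dPot ζ) − ζ∘((L^{j+1})•·)` one has `(Qcoarse L)^[j+1] (Y − dPot ζ) = dPot ψ` (file 1's glue), hence
`Σ_{z∈periodBox N} Σ_κ nhsNormSq (dPot ψ z κ) ≤ ((L^{j+1})^d)⁻¹·(L^{j+1})⁴·Σ_x Σ_π nhsNormSq (curlAt 1 Y x π)`. [folklore] -/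
theorem sum_nhsNormSq_dPot_coexactPot_le_curl {L : ℕ} (hL : 1 ≤ L) {N : ℕ} (hN : 1 ≤ N) {j : ℕ}
    {Y : Site d → Fin d → Matrix n n ℂ} (hYper : IsPeriodicDir Y ((N * L ^ (j + 1) : ℕ) : ℤ))
    (hY : TangentIter L j (flat (d := d) (n := n)) Y)
    {ζ : Site d → Matrix n n ℂ} (hζ : ∀ (x : Site d) (τ : Fin d), ζ (x + ((N * L ^ (j + 1) : ℕ) : ℤ) • e τ) = ζ x)
    (hdiv : ∀ x : Site d, flatDiv (fun y μ => Y y μ - dPot ζ y μ) x = 0) :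
    ∑ z ∈ periodBox (d := d) N, ∑ κ : Fin d,
        nhsNormSq (dPot (fun w => framePot L (j + 1) (fun y μ => Y y μ - dPot ζ y μ) w - ζ (((L : ℤ) ^ (j + 1)) • w)) z κ)
      ≤ ((((L ^ (j + 1) : ℕ) : ℝ)) ^ d)⁻¹ * (((L ^ (j + 1) : ℕ) : ℝ)) ^ 4
          * ∑ x ∈ periodBox (d := d) (N * L ^ (j + 1)), ∑ π : Plane d,
              nhsNormSq (curlAt (flatCfg (d := d) (n := n)) Y x π.1.1 π.1.2) := by
  have hT : (Tcoarse L)^[j + 1] Y = 0 := iterate_Tcoarse_eq_zero_of_tangentIter hL j Y hY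
  rw [← iterate_Qcoarse_coexact_eq_dPot' hL (j + 1) Y ζ hT]
  exact sum_nhsNormSq_iterate_Qcoarse_coexact_le_curl hL hN hYper hY hζ hdiv

/-! ## §3 Operator-norm currency (one factor `card n`) -/

/-- **OPERATOR-NORM BLOCK-POINCARÉ OF THE CO-CLOSED COMPONENT AGAINST THE CURL**:
`dirSq (Y − dPot ζ) (periodBox (N·L^{j+1})) ≤ card n·9·(L^{j+1})²·curlSq 1 Y (periodBox (N·L^{j+1}))`. [folklore] -/
theorem dirSq_coexact_le_curlSq {L : ℕ} (hL : 1 ≤ L) {N : ℕ} (hN : 1 ≤ N) {j : ℕ}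
    {Y : Site d → Fin d → Matrix n n ℂ} (hYper : IsPeriodicDir Y ((N * L ^ (j + 1) : ℕ) : ℤ))
    (hY : TangentIter L j (flat (d := d) (n := n)) Y)
    {ζ : Site d → Matrix n n ℂ} (hζ : ∀ (x : Site d) (τ : Fin d), ζ (x + ((N * L ^ (j + 1) : ℕ) : ℤ) • e τ) = ζ x)
    (hdiv : ∀ x : Site d, flatDiv (fun y μ => Y y μ - dPot ζ y μ) x = 0) :
    dirSq (fun y μ => Y y μ - dPot ζ y μ) (periodBox (d := d) (N * L ^ (j + 1)))
      ≤ Fintype.card n * 9 * ((L : ℝ) ^ (j + 1)) ^ 2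
          * curlSq (flatCfg (d := d) (n := n)) Y (periodBox (d := d) (N * L ^ (j + 1))) := by
  have h := sum_nhsNormSq_coexact_le_curl hL hN hYper hY hζ hdiv
  have hn : (0 : ℝ) ≤ Fintype.card n := Nat.cast_nonneg _
  calc dirSq (fun y μ => Y y μ - dPot ζ y μ) (periodBox (d := d) (N * L ^ (j + 1)))
      ≤ Fintype.card n * ∑ x ∈ periodBox (d := d) (N * L ^ (j + 1)), ∑ κ : Fin d, nhsNormSq (Y x κ - dPot ζ x κ) :=
        dirSq_le_card_mul_sum_nhs _ _
    _ ≤ Fintype.card n * (9 * ((L : ℝ) ^ (j + 1)) ^ 2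
          * ∑ x ∈ periodBox (d := d) (N * L ^ (j + 1)), ∑ π : Plane d,
              nhsNormSq (curlAt (flatCfg (d := d) (n := n)) Y x π.1.1 π.1.2)) :=
        mul_le_mul_of_nonneg_left h hn
    _ ≤ Fintype.card n * (9 * ((L : ℝ) ^ (j + 1)) ^ 2
          * curlSq (flatCfg (d := d) (n := n)) Y (periodBox (d := d) (N * L ^ (j + 1)))) :=
        mul_le_mul_of_nonneg_left (mul_le_mul_of_nonneg_left (sum_nhsNormSq_curl_le_curlSq Y _) (by positivity)) hn
    _ = _ := by ring

/-- **OPERATOR-NORM S-BOUND OF THE CO-CLOSED COMPONENT AGAINST THE CURL**: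
`dirSq ((Qcoarse L)^[j+1] (Y − dPot ζ)) (periodBox N) ≤ card n·((L^{j+1})^d)⁻¹·(L^{j+1})⁴·curlSq 1 Y (periodBox (N·L^{j+1}))`
(`dirSq X G = Σ_{z∈G} Σ_κ ‖X z κ‖²` by `rfl`). [folklore] -/
theorem dirSq_iterate_Qcoarse_coexact_le_curlSq {L : ℕ} (hL : 1 ≤ L) {N : ℕ} (hN : 1 ≤ N) {j : ℕ}
    {Y : Site d → Fin d → Matrix n n ℂ} (hYper : IsPeriodicDir Y ((N * L ^ (j + 1) : ℕ) : ℤ))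
    (hY : TangentIter L j (flat (d := d) (n := n)) Y)
    {ζ : Site d → Matrix n n ℂ} (hζ : ∀ (x : Site d) (τ : Fin d), ζ (x + ((N * L ^ (j + 1) : ℕ) : ℤ) • e τ) = ζ x)
    (hdiv : ∀ x : Site d, flatDiv (fun y μ => Y y μ - dPot ζ y μ) x = 0) :
    dirSq ((Qcoarse L)^[j + 1] (fun y μ => Y y μ - dPot ζ y μ)) (periodBox (d := d) N)
      ≤ Fintype.card n * (((((L ^ (j + 1) : ℕ) : ℝ)) ^ d)⁻¹ * (((L ^ (j + 1) : ℕ) : ℝ)) ^ 4)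
          * curlSq (flatCfg (d := d) (n := n)) Y (periodBox (d := d) (N * L ^ (j + 1))) := by
  have h := sum_nhsNormSq_iterate_Qcoarse_coexact_le_curl hL hN hYper hY hζ hdiv
  have hn : (0 : ℝ) ≤ Fintype.card n := Nat.cast_nonneg _
  calc dirSq ((Qcoarse L)^[j + 1] (fun y μ => Y y μ - dPot ζ y μ)) (periodBox (d := d) N)
      ≤ Fintype.card n * ∑ z ∈ periodBox (d := d) N, ∑ κ : Fin d,
          nhsNormSq ((Qcoarse L)^[j + 1] (fun y μ => Y y μ - dPot ζ y μ) z κ) := dirSq_le_card_mul_sum_nhs _ _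
    _ ≤ Fintype.card n * (((((L ^ (j + 1) : ℕ) : ℝ)) ^ d)⁻¹ * (((L ^ (j + 1) : ℕ) : ℝ)) ^ 4
          * ∑ x ∈ periodBox (d := d) (N * L ^ (j + 1)), ∑ π : Plane d,
              nhsNormSq (curlAt (flatCfg (d := d) (n := n)) Y x π.1.1 π.1.2)) :=
        mul_le_mul_of_nonneg_left h hn
    _ ≤ Fintype.card n * (((((L ^ (j + 1) : ℕ) : ℝ)) ^ d)⁻¹ * (((L ^ (j + 1) : ℕ) : ℝ)) ^ 4
          * curlSq (flatCfg (d := d) (n := n)) Y (periodBox (d := d) (N * L ^ (j + 1)))) :=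
        mul_le_mul_of_nonneg_left (mul_le_mul_of_nonneg_left (sum_nhsNormSq_curl_le_curlSq Y _) (by positivity)) hn
    _ = _ := by ring

end

end Summit.QuantumFields.BalabanUV.T4Continuum.NE3HodgeCoexactPoincareEnd
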